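import Summits.Ventures.PercRepro.PuncturedLYMAllJBridges

/-!
# PercRepro — (SP) BY SUPERPOSITION, PART 16c: (H) AND (C1″) FOR EVERY SPARSE PAVING MATROID — THE DELETION
(p10, gen 32)

A sparse paving matroid of rank `r` on `n ≥ r + 2` points stays sparse paving of rank `r` after deleting a point
(`isSparsePavingF_delete`: the ground set minus `p` has rank `r`, else every `r`-subset avoiding `p` would be dependent and
two of them would meet in `r − 1` points).  The gen-26 bridge (H-gen) ⟹ (H) applies (H-gen) to the deletion `M ∖ p` at
the modular cut of `p`; with Theorem G at the deletion:
* **`capMirrorAt_of_sparsePaving`** — (H) at every point of every sparse paving matroid with `r + 2 ≤ n ≤ 2r − 2`: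
  `κ_k ≤ κ_{N−1−k}` for `2k + 2 ≤ N`;
* **`outCount_le_inCount_succ_of_sparsePaving`** — the per-point form `out_k ≤ in_{k+1}` of Theorem A there;
* **`capLimitPlus_body_of_sparsePaving`** — (C1″) at every point of every such matroid.
Nothing here asserts the global conjectures.
-/

open scoped Matroid

namespace PercRepro.Cogirth

open Finset ThmH Skew

variable {α : Type} [DecidableEq α] {M : Matroid α} [M.Finite]

omit [DecidableEq α] in
/-- Rank is monotone. -/
theorem rk_mono_of_subset {X Y : Finset α} (h : X ⊆ Y) : rk M X ≤ rk M Y := by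
  have := M.eRk_mono (show (X : Set α) ⊆ (Y : Set α) by exact_mod_cast h)
  rw [← coe_rk, ← coe_rk] at this
  exact_mod_cast this

/-- **Sparse paving is closed under the deletion of a point** when `n ≥ r + 2`: `M ∖ p` is sparse paving of rank `r`. -/
theorem isSparsePavingF_delete {r : ℕ} (hsp : IsSparsePavingF M r) (hr2 : r + 2 ≤ (gr M).card) {p : α}
    (hp : p ∈ gr M) : IsSparsePavingF (M ＼ ({p} : Set α)) r := by
  have hgr := gr_delete (M := M) p
  have hsub : (gr M).erase p ⊆ gr M := erase_subset p (gr M)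
  refine ⟨?_, ?_, ?_⟩
  · rw [hgr, rk_delete hsub (notMem_erase p (gr M))]
    apply le_antisymm
    · calc rk M ((gr M).erase p) ≤ rk M (gr M) := rk_mono_of_subset hsub
        _ = r := hsp.1
    · by_contra hlt
      have hlt' : rk M ((gr M).erase p) + 1 ≤ r := by omega
      -- an `(r+1)`-subset `W` of the ground set minus `p`, and two `r`-subsets of it
      obtain ⟨W, hW, hWc⟩ := exists_subset_card_eq (s := (gr M).erase p) (n := r + 1)
        (by rw [card_erase_of_mem hp]; omega)
      obtain ⟨a, ha, b, hb, hab⟩ := one_lt_card.1 (by omega : 1 < W.card)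
      have hWg : W ⊆ gr M := hW.trans hsub
      have hSg : W.erase a ⊆ gr M := (erase_subset _ _).trans hWg
      have hTg : W.erase b ⊆ gr M := (erase_subset _ _).trans hWg
      have hSc : (W.erase a).card = r := by rw [card_erase_of_mem ha, hWc]; rfl
      have hTc : (W.erase b).card = r := by rw [card_erase_of_mem hb, hWc]; rfl
      have hSd : rk M (W.erase a) ≠ (W.erase a).card := by
        have := rk_mono_of_subset (M := M) ((erase_subset a W).trans hW)
        omega
      have hTd : rk M (W.erase b) ≠ (W.erase b).card := by
        have := rk_mono_of_subset (M := M) ((erase_subset b W).trans hW)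
        omega
      have hST : W.erase a ≠ W.erase b := by
        intro h
        have h1 : a ∈ W.erase b := mem_erase.2 ⟨hab, ha⟩
        rw [← h] at h1
        exact (mem_erase.1 h1).1 rfl
      have hkey := hsp.2.2 (W.erase a) hSg (W.erase b) hTg hSc hTc hSd hTd hST
      have hint : (W.erase a ∩ W.erase b).card = r - 1 := by
        have e : W.erase a ∩ W.erase b = (W.erase a).erase b := by
          ext x
          simp only [mem_inter, mem_erase]
          tauto
        rw [e, card_erase_of_mem (mem_erase.2 ⟨fun h => hab h.symm, hb⟩), hSc]
      omega
  · intro S hS hSc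
    rw [hgr] at hS
    have hpS : p ∉ S := fun h => (mem_erase.1 (hS h)).1 rfl
    rw [rk_delete (hS.trans hsub) hpS]
    exact hsp.2.1 S (hS.trans hsub) hSc
  · intro S hS T hT hSc hTc hSd hTd hST
    rw [hgr] at hS hT
    have hpS : p ∉ S := fun h => (mem_erase.1 (hS h)).1 rfl
    have hpT : p ∉ T := fun h => (mem_erase.1 (hT h)).1 rfl
    rw [rk_delete (hS.trans hsub) hpS] at hSd
    rw [rk_delete (hT.trans hsub) hpT] at hTd
    exact hsp.2.2 S (hS.trans hsub) T (hT.trans hsub) hSc hTc hSd hTd hST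

/-- **(H) at every point of every sparse paving matroid** with `r + 2 ≤ n ≤ 2r − 2`: apply (H-gen) at the deletion
`M ∖ p` (sparse paving of rank `r` on `n − 1` points) to the modular cut of `p`. -/
theorem capMirrorAt_of_sparsePaving {r : ℕ} (hsp : IsSparsePavingF M r) (hr2 : r + 2 ≤ (gr M).card)
    (hn : (gr M).card + 2 ≤ 2 * r) {p : α} (hp : p ∈ gr M) : CapMirrorAt M p := by
  intro k hk
  have hN := card_gr_delete (M := M) hp
  have hsp' := isSparsePavingF_delete hsp hr2 hp
  have hsep := sepMirrorAt_of_sparsePaving hsp' (by rw [hN]; omega) (by rw [hN]; omega)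
  have h1 := hsep (modCut M p) (upFlats_modCut p) k (by rw [hN]; omega)
  rw [hN, ← capCount_eq_sepCount_delete_modCut hp, ← capCount_eq_sepCount_delete_modCut hp,
    show (gr M).card - 1 - k = (gr M).card - (k + 1) by omega] at h1
  exact h1

/-- The per-point form `out_k ≤ in_{k+1}` of Theorem A at every point of every sparse paving matroid with
`r + 2 ≤ n ≤ 2r − 2` (`2k + 2 ≤ n`). -/
theorem outCount_le_inCount_succ_of_sparsePaving {r : ℕ} (hsp : IsSparsePavingF M r) (hr2 : r + 2 ≤ (gr M).card)
    (hn : (gr M).card + 2 ≤ 2 * r) {p : α} (hp : p ∈ gr M) {k : ℕ} (hk : 2 * k + 2 ≤ (gr M).card) :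
    outCount M k p ≤ inCount M (k + 1) p :=
  (outCount_le_inCount_succ_iff hp (by omega)).2 (capMirrorAt_of_sparsePaving hsp hr2 hn hp k hk)

/-- **(C1″) at every point of every sparse paving matroid** with `r + 2 ≤ n ≤ 2r − 2`. -/
theorem capLimitPlus_body_of_sparsePaving {r : ℕ} (hsp : IsSparsePavingF M r) (hr2 : r + 2 ≤ (gr M).card)
    (hn : (gr M).card + 2 ≤ 2 * r) {p : α} (hp : p ∈ gr M) :
    ((gr M).card - 1) * ∑ k ∈ range ((gr M).card + 1), capCount M k p ≤
      2 * ∑ k ∈ range ((gr M).card + 1), k * capCount M k p :=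
  capLimitPlus_body_of_capMirrorAt hp (capMirrorAt_of_sparsePaving hsp hr2 hn hp)

end PercRepro.Cogirth
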